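import Summits.AtomisticToContinuum.Crystallization.Theses.SpectralChargeLedger
import Summits.AtomisticToContinuum.Crystallization.Theorems.GappedShellCensusCleanLimitsHaveWindowsLayered
import Literature.MathematicalPhysics.StatisticalMechanics.LocalMatchingCompactness

/-!
# Crux `SpectralChargeLedger.ShellsToLayers` (stmt-AtomisticToContinuum-17254) — ideator 2, round 1:
# first-lemma signatures for the two idea cards

* card `exact-blowup-slot-layering`: `Good`/`Window` read-back (`shellsToLayers_iff`), the transfer target
  `ExactSlotLayering` (C⁺), the dictionary `templateShell_* = range slot*`, the closure lemma
  `exactShell_of_limit`, and the two halves `exactSlotLayering_holds`, `shellsToLayers_of_exactSlotLayering`.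
* card `fixed-tolerance-truss-then-integrate`: `linkExact_of_good` (T1), `StarChart` + `starChart_of_allGood`
  (T2), `window_of_starChart` (T3).

Proved here: `shellsToLayers_of_setForm` (read-back: `GoodIn`/`WindowIn` are the crux's hypothesis/conclusion
definitionally) and the dictionary `templateShell_hcp_eq_range_slotH`, `templateShell_fcc_eq_range_slotC` (with
`InBox.bounds`, `barlowPos_eq_laPt`, `hcpIdx_spec`/`fccIdx_spec` by `decide`). The remaining theorems are
signatures (proofs `sorry`); everything is stated over tree declarations.
-/

noncomputable section

namespace Summit.AtomisticToContinuum.Crystallization.Cruxes.ShellsToLayers.IdeatorTwo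

open Literature.MathematicalPhysics.StatisticalMechanics
open Summit.AtomisticToContinuum.Crystallization.Theorems.CleanHull
open Summit.AtomisticToContinuum.Crystallization.Theses.SpectralChargeLedger

/-- Euclidean `3`-space. -/
local notation "E3" => EuclideanSpace ℝ (Fin 3)

/-! ## Read-back of the crux -/

/-- The punctured open `13/10·a₀`-shell of the origin in a template set `B` (`B = hcpStacking a₀ h₀` or
`fccStacking a₀ h₀`). -/
def templateShell (B : Set E3) (a₀ : ℝ) : Set E3 := {p | p ∈ B ∧ p ≠ 0 ∧ ‖p‖ < 13 / 10 * a₀}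

/-- The punctured open `13/10·a₀`-shell of a point `p` in a set `S`. -/
def shellIn (S : Set E3) (p : E3) (a₀ : ℝ) : Set E3 := {z | z ∈ S ∧ z ≠ p ∧ dist z p < 13 / 10 * a₀}

/-- `τ`-matching of the shell of `p ∈ S` to the template `B` under the linear isometry `A` (bijection,
pointwise `≤ τ`) — the disjunct shape of the route decl. -/
def MatchedWith (S : Set E3) (p : E3) (a₀ τ : ℝ) (B : Set E3) (A : E3 →ₗᵢ[ℝ] E3) : Prop :=
  ∃ e : ↥(shellIn S p a₀) ≃ ↥(templateShell B a₀),
    ∀ t : ↥(shellIn S p a₀), dist ((t : E3) - p) (A ((e t : ↥(templateShell B a₀)) : E3)) ≤ τ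

/-- `τ`-goodness of a point of a set at scale `(a₀, h₀)` — VERBATIM the crux's hypothesis shape
`∃ A, (hcp-matched under A) ∨ (fcc-matched under A)` (checked definitionally in `shellsToLayers_of_setForm`). -/
def GoodIn (a₀ h₀ τ : ℝ) (S : Set E3) (p : E3) : Prop :=
  ∃ A : E3 →ₗᵢ[ℝ] E3, MatchedWith S p a₀ τ (hcpStacking a₀ h₀) A ∨ MatchedWith S p a₀ τ (fccStacking a₀ h₀) A

/-- The layered Barlow-type set of the window format (linear isometry `A`, spacing `a₀`, word `s`, heights `z`). -/
def layeredSet (A : E3 →ₗᵢ[ℝ] E3) (a₀ : ℝ) (s : ℤ → ℤ) (z : ℤ → ℝ) : Set E3 :=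
  {p | ∃ m i j : ℤ, p = A (((i : ℝ) • triangularVec₁ a₀) + ((j : ℝ) • triangularVec₂ a₀) +
    ((haggLabel s m : ℝ) • barlowOffset a₀) + (z m • layerNormal 1))}

/-- The `(R, ε)`-window of the crux for a set `S` (two-way `ε`-match of `S + t` with a layered set on `B(0,R)`). -/
def WindowIn (a₀ R ε : ℝ) (S : Set E3) : Prop :=
  ∃ (A : E3 →ₗᵢ[ℝ] E3) (t : E3) (s : ℤ → ℤ) (z : ℤ → ℝ), IsHaggSeq s ∧
    (∀ m : ℤ, 39 / 50 * a₀ ≤ z (m + 1) - z m ∧ z (m + 1) - z m ≤ 17 / 20 * a₀) ∧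
    (∀ p ∈ layeredSet A a₀ s z, ‖p‖ ≤ R → ∃ q ∈ S, dist (q + t) p ≤ ε) ∧
    (∀ q ∈ S, ‖q + t‖ ≤ R → ∃ p ∈ layeredSet A a₀ s z, dist (q + t) p ≤ ε)

/-- The parameter box of the route. -/
def InBox (a₀ h₀ : ℝ) : Prop := 47 / 50 ≤ a₀ ∧ a₀ ≤ 1 ∧ |h₀ - a₀ * Real.sqrt (2 / 3)| ≤ a₀ / 100

/-- Set form of the crux (configurations enter only through `Set.range y`; δ-separation makes `y` injective,
so `Fin N`-indexed and set-indexed statements agree — `shellsToLayers_of_setForm`). -/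
def SetForm : Prop :=
  ∀ a₀ h₀ : ℝ, InBox a₀ h₀ → ∀ δ : ℝ, 0 < δ → ∀ R ε : ℝ, 0 < ε → ∃ τ R' : ℝ, 0 < τ ∧ τ ≤ 1 ∧
    ∀ S : Set E3, S.Finite → (∀ p ∈ S, ∀ q ∈ S, p ≠ q → δ ≤ dist p q) →
      ∀ p ∈ S, (∀ q ∈ S, dist q p ≤ R' → GoodIn a₀ h₀ τ S q) → WindowIn a₀ R ε S

/-- Read-back: the set form implies the crux as typed (bookkeeping through `Set.range y`; `GoodIn` is the
crux's hypothesis verbatim, `WindowIn` its conclusion up to `∃ k : Fin N` ↔ `∃ q ∈ Set.range y`). -/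
theorem shellsToLayers_of_setForm (h : SetForm) : ShellsToLayers := by
  intro a₀ h₀ ha ha' hh δ hδ R ε hε
  obtain ⟨τ, R', hτ, hτ1, hmain⟩ := h a₀ h₀ ⟨ha, ha', hh⟩ δ hδ R ε hε
  refine ⟨τ, R', hτ, hτ1, fun N y hsep i hgood => ?_⟩
  have hsepS : ∀ p ∈ Set.range y, ∀ q ∈ Set.range y, p ≠ q → δ ≤ dist p q := by
    rintro _ ⟨k, rfl⟩ _ ⟨l, rfl⟩ hkl
    exact hsep k l fun h' => hkl (by rw [h'])
  have hgoodS : ∀ q ∈ Set.range y, dist q (y i) ≤ R' → GoodIn a₀ h₀ τ (Set.range y) q := by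
    rintro _ ⟨j, rfl⟩ hj
    exact hgood j hj
  obtain ⟨A, t, s, z, hs, hz, h1, h2⟩ :=
    hmain (Set.range y) (Set.finite_range y) hsepS (y i) (Set.mem_range_self i) hgoodS
  refine ⟨A, t, s, z, hs, hz, ?_, ?_⟩
  · intro p hp hpR
    obtain ⟨_, ⟨k, rfl⟩, hk⟩ := h1 p hp hpR
    exact ⟨k, hk⟩
  · intro k hk
    obtain ⟨p, hp, hpk⟩ := h2 (y k) (Set.mem_range_self k) hk
    exact ⟨p, hp, hpk⟩

/-! ## Card 1 `exact-blowup-slot-layering` -/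

/-- EXACT template shell at `p ∈ Z`: the punctured open `13/10·a₀`-shell is a rotated copy of the hcp or
fcc template shell (the `τ = 0` case of `GoodIn`). -/
def ExactShell (a₀ h₀ : ℝ) (Z : Set E3) (p : E3) : Prop :=
  ∃ A : E3 →ₗᵢ[ℝ] E3,
    shellIn Z p a₀ = (fun q => p + A q) '' templateShell (hcpStacking a₀ h₀) a₀ ∨
    shellIn Z p a₀ = (fun q => p + A q) '' templateShell (fccStacking a₀ h₀) a₀

/-- **C⁺ (transfer target of card 1).** Exact template shells at every point of a non-empty set force an
exactly layered set with in-layer spacing `a₀` and height increments in the window band. -/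
def ExactSlotLayering (a₀ h₀ : ℝ) : Prop :=
  ∀ Z : Set E3, Z.Nonempty → (∀ p ∈ Z, ExactShell a₀ h₀ Z p) →
    ∃ (A : E3 →ₗᵢ[ℝ] E3) (s : ℤ → ℤ) (z : ℤ → ℝ) (v : E3), IsHaggSeq s ∧
      (∀ m : ℤ, 39 / 50 * a₀ ≤ z (m + 1) - z m ∧ z (m + 1) - z m ≤ 17 / 20 * a₀) ∧
      Z = (fun p => p + v) '' layeredSet A a₀ s z

/-! ### The dictionary (PROVED): template shells = slot models on the whole box -/

theorem sqrt_two_thirds_bounds : (8164 / 10000 : ℝ) < Real.sqrt (2 / 3) ∧ Real.sqrt (2 / 3) < 8166 / 10000 := by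
  constructor
  · rw [Real.lt_sqrt (by norm_num)]; norm_num
  · rw [Real.sqrt_lt' (by norm_num)]; norm_num

theorem InBox.bounds {a₀ h₀ : ℝ} (hb : InBox a₀ h₀) :
    0 < a₀ ∧ 806 / 1000 * a₀ ≤ h₀ ∧ h₀ ≤ 827 / 1000 * a₀ := by
  obtain ⟨ha, ha', hh⟩ := hb
  obtain ⟨h1, h2⟩ := abs_le.1 hh
  obtain ⟨l, u⟩ := sqrt_two_thirds_bounds
  refine ⟨by linarith, ?_, ?_⟩ <;> nlinarith

/-- `barlowPos` through the integer atlas for the three central layers. -/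
theorem barlowPos_eq_laPt (a h : ℝ) (s : ℤ → ℤ) {k : ℤ} (hk : k = -1 ∨ k = 0 ∨ k = 1) (i j : ℤ) :
    barlowPos a h s k i j = laPt a h h (3 * i + haggLabel s k, 3 * j + haggLabel s k, k) := by
  ext l
  fin_cases l
  · simp [laPt, triangularVec₁, triangularVec₂, layerNormal]
    ring
  · simp [laPt, triangularVec₁, triangularVec₂, layerNormal]
    ring
  · rcases hk with rfl | rfl | rfl <;> simp [laPt, laHt, triangularVec₁, triangularVec₂, layerNormal]

/-- The vertical coordinate bounds the norm from below. -/
theorem abs_mul_le_norm_barlowPos (a h : ℝ) (s : ℤ → ℤ) (k i j : ℤ) :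
    |(k : ℝ) * h| ≤ ‖barlowPos a h s k i j‖ := by
  have := PiLp.dist_apply_le (barlowPos a h s k i j) (0 : E3) 2
  simpa [Real.dist_eq] using this

/-- Layer/in-plane indices `(k, i, j)` of the twelve hcp slots. -/
def hcpIdx : Fin 12 → ℤ × ℤ × ℤ :=
  ![(0, 1, 0), (0, -1, 0), (0, 0, 1), (0, 0, -1), (0, 1, -1), (0, -1, 1),
    (1, 0, 0), (1, -1, 0), (1, 0, -1), (-1, 0, 0), (-1, -1, 0), (-1, 0, -1)]

theorem hcpIdx_spec (m : Fin 12) : ((hcpIdx m).1 = -1 ∨ (hcpIdx m).1 = 0 ∨ (hcpIdx m).1 = 1) ∧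
    laCodeH m = (3 * (hcpIdx m).2.1 + (if (hcpIdx m).1 = 0 then 0 else 1),
      3 * (hcpIdx m).2.2 + (if (hcpIdx m).1 = 0 then 0 else 1), (hcpIdx m).1) := by
  revert m; decide

theorem templateShell_hcp_eq_range_slotH {a₀ h₀ : ℝ} (hb : InBox a₀ h₀) :
    templateShell (hcpStacking a₀ h₀) a₀ = Set.range (slotH a₀ h₀ h₀) := by
  obtain ⟨ha0, hlo, hhi⟩ := hb.bounds
  have hh0 : 0 < h₀ := by linarith
  ext p
  simp only [templateShell, Set.mem_setOf_eq, Set.mem_range, hcpStacking, barlowStacking]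
  constructor
  · rintro ⟨⟨k, i, j, rfl⟩, hne, hnorm⟩
    -- the layer index is -1, 0 or 1
    have hz := abs_mul_le_norm_barlowPos a₀ h₀ alternatingHagg k i j
    have h1 : |(k : ℝ)| * h₀ < 13 / 10 * a₀ := by
      rw [abs_mul, abs_of_pos hh0] at hz
      exact hz.trans_lt hnorm
    have h2 : |(k : ℝ)| < 2 := by
      nlinarith [mul_nonneg (abs_nonneg (k : ℝ)) (sub_nonneg.2 hlo), abs_nonneg (k : ℝ)]
    have h3 : |k| < 2 := by exact_mod_cast h2
    have hk : k = -1 ∨ k = 0 ∨ k = 1 := by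
      rcases abs_lt.1 h3 with ⟨h4, h5⟩
      omega
    have hsq : ‖barlowPos a₀ h₀ alternatingHagg k i j‖ ^ 2 < (13 / 10 * a₀) ^ 2 :=
      pow_lt_pow_left₀ hnorm (norm_nonneg _) two_ne_zero
    rw [barlowPos_eq_laPt a₀ h₀ alternatingHagg hk] at hsq hne ⊢
    rw [norm_laPt_sq] at hsq
    rcases hk with rfl | rfl | rfl
    · -- k = -1, label 1
      have hL : haggLabel alternatingHagg (-1) = 1 := by rw [haggLabel_alternating]; decide
      rw [hL] at hsq hne ⊢
      simp only [laHt] at hsq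
      norm_num at hsq
      push_cast at hsq
      have hQ : (i : ℝ) ^ 2 + i * j + j ^ 2 + i + j < 71 / 100 := by nlinarith
      have hQ' : i ^ 2 + i * j + j ^ 2 + i + j ≤ 0 := by
        have : ((i ^ 2 + i * j + j ^ 2 + i + j : ℤ) : ℝ) < 1 := by push_cast; linarith
        have : i ^ 2 + i * j + j ^ 2 + i + j < 1 := by exact_mod_cast this
        omega
      have hj1 : 3 * j ^ 2 + 2 * j - 1 ≤ 0 := by nlinarith [sq_nonneg (2 * i + j + 1)]
      have hi1 : 3 * i ^ 2 + 2 * i - 1 ≤ 0 := by nlinarith [sq_nonneg (2 * j + i + 1)]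
      have hj2 : -1 ≤ j := by nlinarith
      have hj3 : j ≤ 0 := by nlinarith
      have hi2 : -1 ≤ i := by nlinarith
      have hi3 : i ≤ 0 := by nlinarith
      interval_cases i <;> interval_cases j
      · norm_num at hQ'
      · exact ⟨10, by rw [slotH_eq_laPt]; exact congrArg _ (by decide)⟩
      · exact ⟨11, by rw [slotH_eq_laPt]; exact congrArg _ (by decide)⟩
      · exact ⟨9, by rw [slotH_eq_laPt]; exact congrArg _ (by decide)⟩
    · -- k = 0, label 0
      have hL : haggLabel alternatingHagg 0 = 0 := by simp
      rw [hL] at hsq hne ⊢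
      simp only [laHt] at hsq
      norm_num at hsq
      push_cast at hsq
      have hQ : (i : ℝ) ^ 2 + i * j + j ^ 2 < 169 / 100 := by nlinarith
      have hQ' : i ^ 2 + i * j + j ^ 2 ≤ 1 := by
        have : ((i ^ 2 + i * j + j ^ 2 : ℤ) : ℝ) < 2 := by push_cast; linarith
        have : i ^ 2 + i * j + j ^ 2 < 2 := by exact_mod_cast this
        omega
      have hne' : (i, j) ≠ (0, 0) := by
        rintro ⟨⟩
        apply hne
        simp [laPt, laHt]
      have hQ1 : 1 ≤ i ^ 2 + i * j + j ^ 2 := one_le_sq_add_mul_add_sq (by simpa using hne')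
      have hj1 : 3 * j ^ 2 ≤ 4 := by nlinarith [sq_nonneg (2 * i + j)]
      have hi1 : 3 * i ^ 2 ≤ 4 := by nlinarith [sq_nonneg (2 * j + i)]
      have hj2 : -1 ≤ j := by nlinarith
      have hj3 : j ≤ 1 := by nlinarith
      have hi2 : -1 ≤ i := by nlinarith
      have hi3 : i ≤ 1 := by nlinarith
      interval_cases i <;> interval_cases j
      · norm_num at hQ'
      · exact ⟨1, by rw [slotH_eq_laPt]; exact congrArg _ (by decide)⟩  -- (-1,0)
      · exact ⟨5, by rw [slotH_eq_laPt]; exact congrArg _ (by decide)⟩  -- (-1,1)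
      · exact ⟨3, by rw [slotH_eq_laPt]; exact congrArg _ (by decide)⟩  -- (0,-1)
      · norm_num at hQ1
      · exact ⟨2, by rw [slotH_eq_laPt]; exact congrArg _ (by decide)⟩  -- (0,1)
      · exact ⟨4, by rw [slotH_eq_laPt]; exact congrArg _ (by decide)⟩  -- (1,-1)
      · exact ⟨0, by rw [slotH_eq_laPt]; exact congrArg _ (by decide)⟩  -- (1,0)
      · norm_num at hQ'
    · -- k = 1, label 1
      have hL : haggLabel alternatingHagg 1 = 1 := by rw [haggLabel_alternating]; decide
      rw [hL] at hsq hne ⊢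
      simp only [laHt] at hsq
      norm_num at hsq
      push_cast at hsq
      have hQ : (i : ℝ) ^ 2 + i * j + j ^ 2 + i + j < 71 / 100 := by nlinarith
      have hQ' : i ^ 2 + i * j + j ^ 2 + i + j ≤ 0 := by
        have : ((i ^ 2 + i * j + j ^ 2 + i + j : ℤ) : ℝ) < 1 := by push_cast; linarith
        have : i ^ 2 + i * j + j ^ 2 + i + j < 1 := by exact_mod_cast this
        omega
      have hj1 : 3 * j ^ 2 + 2 * j - 1 ≤ 0 := by nlinarith [sq_nonneg (2 * i + j + 1)]
      have hi1 : 3 * i ^ 2 + 2 * i - 1 ≤ 0 := by nlinarith [sq_nonneg (2 * j + i + 1)]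
      have hj2 : -1 ≤ j := by nlinarith
      have hj3 : j ≤ 0 := by nlinarith
      have hi2 : -1 ≤ i := by nlinarith
      have hi3 : i ≤ 0 := by nlinarith
      interval_cases i <;> interval_cases j
      · norm_num at hQ'
      · exact ⟨7, by rw [slotH_eq_laPt]; exact congrArg _ (by decide)⟩
      · exact ⟨8, by rw [slotH_eq_laPt]; exact congrArg _ (by decide)⟩
      · exact ⟨6, by rw [slotH_eq_laPt]; exact congrArg _ (by decide)⟩
  · rintro ⟨m, rfl⟩
    obtain ⟨hk, hcode⟩ := hcpIdx_spec m
    have hLab : haggLabel alternatingHagg (hcpIdx m).1 = (if (hcpIdx m).1 = 0 then 0 else 1) := by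
      rcases hk with h | h | h <;> rw [h, haggLabel_alternating] <;> decide
    refine ⟨⟨(hcpIdx m).1, (hcpIdx m).2.1, (hcpIdx m).2.2, ?_⟩, ?_, ?_⟩
    · rw [barlowPos_eq_laPt _ _ _ hk, slotH_eq_laPt, hcode, hLab]
    · intro h0
      have hn := la_norm_code (kp := h₀) (km := h₀) ha0 false m
      simp only [laCode, Bool.false_eq_true, ↓reduceIte] at hn
      rw [← slotH_eq_laPt, h0, norm_zero] at hn
      rcases hn with ⟨-, hn⟩ | ⟨-, hn⟩ | ⟨-, hn⟩ <;> nlinarith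
    · have hn := la_norm_code (kp := h₀) (km := h₀) ha0 false m
      simp only [laCode, Bool.false_eq_true, ↓reduceIte] at hn
      rw [← slotH_eq_laPt] at hn
      have hlt : ‖slotH a₀ h₀ h₀ m‖ ^ 2 < (13 / 10 * a₀) ^ 2 := by
        rcases hn with ⟨-, hn⟩ | ⟨-, hn⟩ | ⟨-, hn⟩
        · rw [hn]; nlinarith
        · rw [hn]; nlinarith
        · rw [hn]; nlinarith
      exact lt_of_pow_lt_pow_left₀ 2 (by positivity) hlt

/-- Layer/in-plane indices `(k, i, j)` of the twelve fcc slots. -/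
def fccIdx : Fin 12 → ℤ × ℤ × ℤ :=
  ![(0, 1, 0), (0, -1, 0), (0, 0, 1), (0, 0, -1), (0, 1, -1), (0, -1, 1),
    (1, 0, 0), (1, -1, 0), (1, 0, -1), (-1, 0, 0), (-1, 1, 0), (-1, 0, 1)]

theorem fccIdx_spec (m : Fin 12) : ((fccIdx m).1 = -1 ∨ (fccIdx m).1 = 0 ∨ (fccIdx m).1 = 1) ∧
    laCodeC m = (3 * (fccIdx m).2.1 + (fccIdx m).1, 3 * (fccIdx m).2.2 + (fccIdx m).1, (fccIdx m).1) := by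
  revert m; decide

theorem templateShell_fcc_eq_range_slotC {a₀ h₀ : ℝ} (hb : InBox a₀ h₀) :
    templateShell (fccStacking a₀ h₀) a₀ = Set.range (slotC a₀ h₀ h₀) := by
  obtain ⟨ha0, hlo, hhi⟩ := hb.bounds
  have hh0 : 0 < h₀ := by linarith
  ext p
  simp only [templateShell, Set.mem_setOf_eq, Set.mem_range, fccStacking, barlowStacking]
  constructor
  · rintro ⟨⟨k, i, j, rfl⟩, hne, hnorm⟩
    have hz := abs_mul_le_norm_barlowPos a₀ h₀ constHagg k i j
    have h1 : |(k : ℝ)| * h₀ < 13 / 10 * a₀ := by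
      rw [abs_mul, abs_of_pos hh0] at hz
      exact hz.trans_lt hnorm
    have h2 : |(k : ℝ)| < 2 := by
      nlinarith [mul_nonneg (abs_nonneg (k : ℝ)) (sub_nonneg.2 hlo), abs_nonneg (k : ℝ)]
    have h3 : |k| < 2 := by exact_mod_cast h2
    have hk : k = -1 ∨ k = 0 ∨ k = 1 := by
      rcases abs_lt.1 h3 with ⟨h4, h5⟩
      omega
    have hsq : ‖barlowPos a₀ h₀ constHagg k i j‖ ^ 2 < (13 / 10 * a₀) ^ 2 :=
      pow_lt_pow_left₀ hnorm (norm_nonneg _) two_ne_zero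
    rw [barlowPos_eq_laPt a₀ h₀ constHagg hk] at hsq hne ⊢
    rw [norm_laPt_sq] at hsq
    simp only [haggLabel_const] at hsq hne ⊢
    rcases hk with rfl | rfl | rfl
    · -- k = -1, label -1
      simp only [laHt] at hsq
      norm_num at hsq
      push_cast at hsq
      have hQ : (i : ℝ) ^ 2 + i * j + j ^ 2 - i - j < 71 / 100 := by nlinarith
      have hQ' : i ^ 2 + i * j + j ^ 2 - i - j ≤ 0 := by
        have : ((i ^ 2 + i * j + j ^ 2 - i - j : ℤ) : ℝ) < 1 := by push_cast; linarith
        have : i ^ 2 + i * j + j ^ 2 - i - j < 1 := by exact_mod_cast this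
        omega
      have hj1 : 3 * j ^ 2 - 2 * j - 1 ≤ 0 := by nlinarith [sq_nonneg (2 * i + j - 1)]
      have hi1 : 3 * i ^ 2 - 2 * i - 1 ≤ 0 := by nlinarith [sq_nonneg (2 * j + i - 1)]
      have hj2 : 0 ≤ j := by nlinarith
      have hj3 : j ≤ 1 := by nlinarith
      have hi2 : 0 ≤ i := by nlinarith
      have hi3 : i ≤ 1 := by nlinarith
      interval_cases i <;> interval_cases j
      · exact ⟨9, by rw [slotC_eq_laPt]; exact congrArg _ (by decide)⟩
      · exact ⟨11, by rw [slotC_eq_laPt]; exact congrArg _ (by decide)⟩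
      · exact ⟨10, by rw [slotC_eq_laPt]; exact congrArg _ (by decide)⟩
      · norm_num at hQ'
    · -- k = 0, label 0
      simp only [laHt] at hsq
      norm_num at hsq
      push_cast at hsq
      have hQ : (i : ℝ) ^ 2 + i * j + j ^ 2 < 169 / 100 := by nlinarith
      have hQ' : i ^ 2 + i * j + j ^ 2 ≤ 1 := by
        have : ((i ^ 2 + i * j + j ^ 2 : ℤ) : ℝ) < 2 := by push_cast; linarith
        have : i ^ 2 + i * j + j ^ 2 < 2 := by exact_mod_cast this
        omega
      have hne' : (i, j) ≠ (0, 0) := by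
        rintro ⟨⟩
        apply hne
        simp [laPt, laHt]
      have hQ1 : 1 ≤ i ^ 2 + i * j + j ^ 2 := one_le_sq_add_mul_add_sq (by simpa using hne')
      have hj1 : 3 * j ^ 2 ≤ 4 := by nlinarith [sq_nonneg (2 * i + j)]
      have hi1 : 3 * i ^ 2 ≤ 4 := by nlinarith [sq_nonneg (2 * j + i)]
      have hj2 : -1 ≤ j := by nlinarith
      have hj3 : j ≤ 1 := by nlinarith
      have hi2 : -1 ≤ i := by nlinarith
      have hi3 : i ≤ 1 := by nlinarith
      interval_cases i <;> interval_cases j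
      · norm_num at hQ'
      · exact ⟨1, by rw [slotC_eq_laPt]; exact congrArg _ (by decide)⟩
      · exact ⟨5, by rw [slotC_eq_laPt]; exact congrArg _ (by decide)⟩
      · exact ⟨3, by rw [slotC_eq_laPt]; exact congrArg _ (by decide)⟩
      · norm_num at hQ1
      · exact ⟨2, by rw [slotC_eq_laPt]; exact congrArg _ (by decide)⟩
      · exact ⟨4, by rw [slotC_eq_laPt]; exact congrArg _ (by decide)⟩
      · exact ⟨0, by rw [slotC_eq_laPt]; exact congrArg _ (by decide)⟩
      · norm_num at hQ'
    · -- k = 1, label 1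
      simp only [laHt] at hsq
      norm_num at hsq
      push_cast at hsq
      have hQ : (i : ℝ) ^ 2 + i * j + j ^ 2 + i + j < 71 / 100 := by nlinarith
      have hQ' : i ^ 2 + i * j + j ^ 2 + i + j ≤ 0 := by
        have : ((i ^ 2 + i * j + j ^ 2 + i + j : ℤ) : ℝ) < 1 := by push_cast; linarith
        have : i ^ 2 + i * j + j ^ 2 + i + j < 1 := by exact_mod_cast this
        omega
      have hj1 : 3 * j ^ 2 + 2 * j - 1 ≤ 0 := by nlinarith [sq_nonneg (2 * i + j + 1)]
      have hi1 : 3 * i ^ 2 + 2 * i - 1 ≤ 0 := by nlinarith [sq_nonneg (2 * j + i + 1)]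
      have hj2 : -1 ≤ j := by nlinarith
      have hj3 : j ≤ 0 := by nlinarith
      have hi2 : -1 ≤ i := by nlinarith
      have hi3 : i ≤ 0 := by nlinarith
      interval_cases i <;> interval_cases j
      · norm_num at hQ'
      · exact ⟨7, by rw [slotC_eq_laPt]; exact congrArg _ (by decide)⟩
      · exact ⟨8, by rw [slotC_eq_laPt]; exact congrArg _ (by decide)⟩
      · exact ⟨6, by rw [slotC_eq_laPt]; exact congrArg _ (by decide)⟩
  · rintro ⟨m, rfl⟩
    obtain ⟨hk, hcode⟩ := fccIdx_spec m
    refine ⟨⟨(fccIdx m).1, (fccIdx m).2.1, (fccIdx m).2.2, ?_⟩, ?_, ?_⟩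
    · rw [barlowPos_eq_laPt _ _ _ hk, slotC_eq_laPt, hcode, haggLabel_const]
    · intro h0
      have hn := la_norm_code (kp := h₀) (km := h₀) ha0 true m
      simp only [laCode, ↓reduceIte] at hn
      rw [← slotC_eq_laPt, h0, norm_zero] at hn
      rcases hn with ⟨-, hn⟩ | ⟨-, hn⟩ | ⟨-, hn⟩ <;> nlinarith
    · have hn := la_norm_code (kp := h₀) (km := h₀) ha0 true m
      simp only [laCode, ↓reduceIte] at hn
      rw [← slotC_eq_laPt] at hn
      have hlt : ‖slotC a₀ h₀ h₀ m‖ ^ 2 < (13 / 10 * a₀) ^ 2 := by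
        rcases hn with ⟨-, hn⟩ | ⟨-, hn⟩ | ⟨-, hn⟩
        · rw [hn]; nlinarith
        · rw [hn]; nlinarith
        · rw [hn]; nlinarith
      exact lt_of_pow_lt_pow_left₀ 2 (by positivity) hlt


/-- Radial band of the slots on the box: every slot of either model has norm in `[0.98a₀, 1.02a₀]`. -/
theorem laSlot_norm_band {a₀ h₀ : ℝ} (hb : InBox a₀ h₀) (t : Bool) (k : Fin 12) :
    a₀ * (1 - 1 / 50) ≤ ‖laSlot t a₀ h₀ h₀ k‖ ∧ ‖laSlot t a₀ h₀ h₀ k‖ ≤ a₀ * (1 + 1 / 50) := by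
  obtain ⟨ha0, hlo, hhi⟩ := hb.bounds
  have hn := la_norm_code (kp := h₀) (km := h₀) ha0 t k
  rw [← laSlot_eq_laPt] at hn
  have h0 : 0 ≤ ‖laSlot t a₀ h₀ h₀ k‖ := norm_nonneg _
  rcases hn with ⟨-, hn⟩ | ⟨-, hn⟩ | ⟨-, hn⟩
  · rw [hn]; constructor <;> nlinarith
  · constructor
    · exact (pow_le_pow_iff_left₀ (by nlinarith) h0 two_ne_zero).1 (by rw [hn]; nlinarith)
    · exact (pow_le_pow_iff_left₀ h0 (by nlinarith) two_ne_zero).1 (by rw [hn]; nlinarith)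
  · constructor
    · exact (pow_le_pow_iff_left₀ (by nlinarith) h0 two_ne_zero).1 (by rw [hn]; nlinarith)
    · exact (pow_le_pow_iff_left₀ h0 (by nlinarith) two_ne_zero).1 (by rw [hn]; nlinarith)

/-- An exact shell, read through the dictionary: the punctured open `1.3a₀`-shell of `p` is the rotated slot model
of one of the two types, translated to `p`. -/
theorem exactShell_iff_laSlot {a₀ h₀ : ℝ} (hb : InBox a₀ h₀) {Z : Set E3} {p : E3} :
    ExactShell a₀ h₀ Z p ↔ ∃ (A : E3 →ₗᵢ[ℝ] E3) (t : Bool),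
      shellIn Z p a₀ = Set.range fun k : Fin 12 => p + A (laSlot t a₀ h₀ h₀ k) := by
  unfold ExactShell
  rw [templateShell_hcp_eq_range_slotH hb, templateShell_fcc_eq_range_slotC hb]
  constructor
  · rintro ⟨A, h | h⟩
    · exact ⟨A, false, by rw [h, ← Set.range_comp]; rfl⟩
    · exact ⟨A, true, by rw [h, ← Set.range_comp]; rfl⟩
  · rintro ⟨A, t, h⟩
    cases t
    · exact ⟨A, Or.inl (by rw [h, ← Set.range_comp]; rfl)⟩
    · exact ⟨A, Or.inr (by rw [h, ← Set.range_comp]; rfl)⟩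

/-- **Dictionary into the landed chain (PROVED).** Exact template shells everywhere give, at scale `a := a₀`, the
gap clause `hgap` and the exact-slot clause `hexact` of `CleanHull.stub_firstLayer / stub_layerStepUp /
stub_layeredOfExactShells` (radial band `[0.98a₀, 1.02a₀]` from `laSlot_norm_band`; gap: nothing else below
`1.3a₀ ≥ 1.26a₀`). -/
theorem cleanHull_hyps_of_exactShell {a₀ h₀ : ℝ} (hb : InBox a₀ h₀) {Z : Set E3}
    (hZ : ∀ p ∈ Z, ExactShell a₀ h₀ Z p) :
    (∀ y ∈ Z, ∀ w ∈ Z, w ≠ y → a₀ * (1 - 1 / 50) ≤ dist y w ∧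
      (dist y w ≤ a₀ * (1 + 1 / 50) ∨ a₀ * (63 / 50) ≤ dist y w)) ∧
    (∀ p ∈ Z, ∃ (a' hp' hm' : ℝ) (A : E3 →ₗᵢ[ℝ] E3), 0 < a' ∧ 0 < hp' ∧ 0 < hm' ∧
      ((bondShell a₀ Z p = Set.range fun k : Fin 12 => p + A (slotC a' hp' hm' k)) ∨
       (bondShell a₀ Z p = Set.range fun k : Fin 12 => p + A (slotH a' hp' hm' k)))) := by
  obtain ⟨ha0, hlo, hhi⟩ := hb.bounds
  have hh0 : 0 < h₀ := by linarith
  -- distances from a site to the points of its shell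
  have hshell : ∀ p ∈ Z, ∃ (A : E3 →ₗᵢ[ℝ] E3) (t : Bool),
      shellIn Z p a₀ = Set.range (fun k : Fin 12 => p + A (laSlot t a₀ h₀ h₀ k)) :=
    fun p hp => (exactShell_iff_laSlot hb).1 (hZ p hp)
  have hband : ∀ p ∈ Z, ∀ w ∈ shellIn Z p a₀,
      a₀ * (1 - 1 / 50) ≤ dist p w ∧ dist p w ≤ a₀ * (1 + 1 / 50) := by
    intro p hp w hw
    obtain ⟨A, t, hA⟩ := hshell p hp
    rw [hA] at hw
    obtain ⟨k, rfl⟩ := hw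
    have : dist p (p + A (laSlot t a₀ h₀ h₀ k)) = ‖laSlot t a₀ h₀ h₀ k‖ := by
      rw [dist_eq_norm]; simp
    rw [this]
    exact laSlot_norm_band hb t k
  refine ⟨fun y hy w hw hwy => ?_, fun p hp => ?_⟩
  · by_cases hd : dist w y < 13 / 10 * a₀
    · have hw' : w ∈ shellIn Z y a₀ := ⟨hw, hwy, hd⟩
      obtain ⟨h1, h2⟩ := hband y hy w hw'
      exact ⟨h1, Or.inl h2⟩
    · push_neg at hd
      rw [dist_comm] at hd
      constructor
      · nlinarith
      · exact Or.inr (by nlinarith)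
  · obtain ⟨A, t, hA⟩ := hshell p hp
    have hbond : bondShell a₀ Z p = Set.range (fun k : Fin 12 => p + A (laSlot t a₀ h₀ h₀ k)) := by
      rw [← hA]
      ext w
      simp only [bondShell, shellIn, Set.mem_setOf_eq]
      constructor
      · rintro ⟨hw, hwp, hd⟩
        refine ⟨hw, hwp, ?_⟩
        rw [dist_comm]; nlinarith
      · rintro ⟨hw, hwp, hd⟩
        refine ⟨hw, hwp, ?_⟩
        exact (hband p hp w ⟨hw, hwp, hd⟩).2
    refine ⟨a₀, h₀, h₀, A, ha0, hh0, hh0, ?_⟩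
    cases t
    · exact Or.inr (by rw [hbond]; rfl)
    · exact Or.inl (by rw [hbond]; rfl)

/-- **C⁺ holds** (card 1, second half): `ExactSlotLayering` from the landed `stub_layeredOfExactShells`
(strengthened re-export keeping the increment band of `stub_layerStepUp/Down`) plus the pinning `a' = a₀`
(the in-plane hexagon of the layered set is coplanar with its centre, so under the shell isometry it is the
template hexagon of side `a₀`, not the six off-plane points). -/
theorem exactSlotLayering_holds {a₀ h₀ : ℝ} (hb : InBox a₀ h₀) : ExactSlotLayering a₀ h₀ := by
  sorry

/-- **Closure lemma (card 1, FIRST LEMMA).** A local limit `Y` (two-way matched on every ball, eventually)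
of uniformly separated sets `Ys k` whose points within radius `ρ k → ∞` of the origin are `τ k`-good with
`τ k → 0` has EXACT template shells at every point.  Isometry-free carrier: the cluster misfit of the shell
of an approximating point against the fixed slot model `slot* a₀ h₀ h₀` is `≤ C·τ k`, it is continuous in the
thirteen positions, so it vanishes on the limit shell, and a vanishing misfit is congruence
(`CleanHull.shell_eq_range_of_clusterMisfit_eq_zero`). -/
theorem exactShell_of_limit {a₀ h₀ δ : ℝ} (hb : InBox a₀ h₀) (hδ : 0 < δ)
    (Ys : ℕ → Set E3) (Y : Set E3) (τ ρ : ℕ → ℝ)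
    (hsep : ∀ k, ∀ p ∈ Ys k, ∀ q ∈ Ys k, p ≠ q → δ ≤ dist p q)
    (hgood : ∀ k, ∀ q ∈ Ys k, ‖q‖ ≤ ρ k → GoodIn a₀ h₀ (τ k) (Ys k) q)
    (hτ : Filter.Tendsto τ Filter.atTop (nhds 0)) (hρ : Filter.Tendsto ρ Filter.atTop Filter.atTop)
    (hYsep : ∀ p ∈ Y, ∀ q ∈ Y, p ≠ q → δ ≤ dist p q)
    (hlim : ∀ R ε : ℝ, 0 < ε → ∀ᶠ k in Filter.atTop, BallMatch ε R 0 (Ys k) Y) :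
    ∀ p ∈ Y, ExactShell a₀ h₀ Y p := by
  sorry

/-- **Card 1 assembled direction:** `C⁺` on the box implies the crux — negate, recentre the bad sites at the
origin, extract a local limit (`exists_subseq_forall_eventually_ballMatch`), close (`exactShell_of_limit`;
the limit contains `0`), layer (`C⁺`), and transfer the layered picture of `Y` back to `Ys k` on `B(0, R)`
through the ball match at radius `R + ‖v‖ + 1` with `ε/2`. -/
theorem setForm_of_exactSlotLayering (h : ∀ a₀ h₀ : ℝ, InBox a₀ h₀ → ExactSlotLayering a₀ h₀) :
    SetForm := by
  sorry

/-! ## Card 2 `fixed-tolerance-truss-then-integrate` -/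

/-- **T1 (links are exact at a fixed tolerance).** For `τ ≤ a₀/200` the matching bijection of a good site
carries "distance `≤ 23/20·a₀`" on its shell EXACTLY to template adjacency "distance `≤ 101/100·a₀`":
adjacent template pairs are `≤ max(a₀, b) ≤ 1.0082 a₀` apart, non-adjacent ones `≥ 1.39 a₀`. Uses ONE shell. -/
theorem linkExact_of_good {a₀ h₀ τ : ℝ} (hb : InBox a₀ h₀) (hτ : 0 < τ) (hτ' : τ ≤ a₀ / 200)
    {S : Set E3} {p : E3} {B : Set E3} (hB : B = hcpStacking a₀ h₀ ∨ B = fccStacking a₀ h₀)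
    (A : E3 →ₗᵢ[ℝ] E3) (e : ↥(shellIn S p a₀) ≃ ↥(templateShell B a₀))
    (he : ∀ t : ↥(shellIn S p a₀), dist ((t : E3) - p) (A ((e t : ↥(templateShell B a₀)) : E3)) ≤ τ) :
    ∀ t t' : ↥(shellIn S p a₀),
      (dist (t : E3) (t' : E3) ≤ 23 / 20 * a₀ ↔
        dist ((e t : ↥(templateShell B a₀)) : E3) ((e t' : ↥(templateShell B a₀)) : E3) ≤ 101 / 100 * a₀) := by
  sorry

/-- The model point of index `c = (k, i, j)` for word `s` at the relaxed cell `(a₀, h₀)`. -/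
def modelPt (a₀ h₀ : ℝ) (s : ℤ → ℤ) (c : ℤ × ℤ × ℤ) : E3 := barlowPos a₀ h₀ s c.1 c.2.1 c.2.2

/-- **Finite star chart (output of T2, input of T3).** A word `s` and an index map `Φ` into `S` on the
model ball of radius `L` about the origin index, sending `(0,0,0)` to `p`, such that every indexed star is
`τ`-congruent to its model star (one linear isometry per index) and every point of `S` within `L - 2a₀` of
`p` is indexed. -/
def StarChart (a₀ h₀ τ L : ℝ) (S : Set E3) (p : E3) : Prop :=
  ∃ (s : ℤ → ℤ) (Φ : ℤ × ℤ × ℤ → E3), IsHaggSeq s ∧ Φ (0, 0, 0) = p ∧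
    (∀ c, ‖modelPt a₀ h₀ s c‖ ≤ L → Φ c ∈ S) ∧
    (∀ c, ‖modelPt a₀ h₀ s c‖ ≤ L → ∃ A : E3 →ₗᵢ[ℝ] E3, ∀ c',
      dist (modelPt a₀ h₀ s c') (modelPt a₀ h₀ s c) ≤ 101 / 100 * a₀ →
        dist (Φ c' - Φ c) (A (modelPt a₀ h₀ s c' - modelPt a₀ h₀ s c)) ≤ τ) ∧
    (∀ q ∈ S, dist q p ≤ L - 2 * a₀ → ∃ c, ‖modelPt a₀ h₀ s c‖ ≤ L ∧ Φ c = q)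

/-- **T2 (combinatorial layering on a finite ball, at fixed tolerance).** All-good on `B(p, R')` with
`τ ≤ a₀/200` gives a star chart of radius `L` about `p` once `R' ≥ L + 4a₀`: disc version of the landed layer
propagation (`CleanHull.stub_firstLayer`, `stub_layerStepUp/Down`; Hales DSP §1.3), run on the exact links of
T1 with one bond of radius lost per step; the stars' `τ`-congruence is the sites' own goodness read in chart
labels. -/
theorem starChart_of_allGood {a₀ h₀ τ δ : ℝ} (hb : InBox a₀ h₀) (hτ : 0 < τ) (hτ' : τ ≤ a₀ / 200)
    (hδ : 0 < δ) {S : Set E3} (hS : S.Finite) (hsep : ∀ p ∈ S, ∀ q ∈ S, p ≠ q → δ ≤ dist p q)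
    {p : E3} (hp : p ∈ S) {L R' : ℝ} (hL : 0 ≤ L) (hR' : L + 4 * a₀ ≤ R')
    (hgood : ∀ q ∈ S, dist q p ≤ R' → GoodIn a₀ h₀ τ S q) :
    StarChart a₀ h₀ τ L S p := by
  sorry

/-- **T3 (metric integration).** A star chart of radius `3R + 10a₀` whose stars are `τ`-congruent to the
model is, after one rigid motion, `ε`-close to the model on `B(0, R)` — hence a window — as soon as
`τ ≤ τ₁(a₀, R, ε)`: place sites outward from `p` along chart paths; two linear isometries that `τ`-agree on
the six points of a bond star (affinely spanning, fatness `≍ a₀`) differ by `O(τ/a₀)`, so the error after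
`n ≲ R/a₀` steps is `O(n² τ)`; any explicit `τ₁ > 0` will do since `τ` is chosen after `(R, ε)`. -/
theorem window_of_starChart {a₀ h₀ : ℝ} (hb : InBox a₀ h₀) (R ε : ℝ) (hε : 0 < ε) :
    ∃ τ₁ : ℝ, 0 < τ₁ ∧ ∀ τ : ℝ, 0 < τ → τ ≤ τ₁ → ∀ (S : Set E3) (p : E3), p ∈ S →
      StarChart a₀ h₀ τ (3 * R + 10 * a₀) S p → WindowIn a₀ R ε S := by
  sorry

/-- **Card 2 assembled:** `τ := min (a₀/200) τ₁`, `R' := 3R + 14a₀`. -/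
theorem setForm_of_T2_T3 : SetForm := by
  sorry

end Summit.AtomisticToContinuum.Crystallization.Cruxes.ShellsToLayers.IdeatorTwo
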